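import Mathlib
import Summits.AtomisticToContinuum.Crystallization.Theses.OneCentreSteepnessLadder
import Summits.AtomisticToContinuum.Crystallization.Theorems.OneCentreSteepnessLadderZeroDensityOfDefectsTrialBlocks
import HarnessLib

/-!
# Route `OneCentreSteepnessLadder`, item `ZeroDensityOfDefects` (stmt-AtomisticToContinuum-12886):
# zero density of defective centres from coercive one-centre domination

Closes `Summit.AtomisticToContinuum.Crystallization.Theses.OneCentreSteepnessLadder.ZeroDensityOfDefects`
(`oneCentreSteepnessLadder_zeroDensityOfDefects`, at the end), after the last helper step:

* THE TRIAL BOUND (`trial_bound`): for `a, h > 0`, `q ≥ 4` and every `θ > 0`, eventually in `N`,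
  `4q · E_{V_q}(N) ≤ N · (θ − Φ_hcp)`, `Φ_hcp = Σ'_{p ∈ hcpStacking a h} φ_q(‖p‖)`
  (`φ_q = 2r⁻ᵠ − r⁻²ᵠ = −2q V_q`): take `K` minimal with `#F·K³ ≥ N`, a sub-configuration of `N`
  points of the HCP block (`four_q_groundStateEnergy_card_le`: `4q·E(#S) ≤ 4q·𝓔(block_K) +
  6·#Sᶜ·1024/(m³m^{q−3})` from `two_mul_groundStateEnergy_card_le` and the row bound), the block
  bound `four_q_energy_block_le` with `R` large, `K³ ≤ 8N` and `#F K³ − N ≤ 3 #F K²`.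
* THE ITEM: fix `η > 0` with its gain `γ > 0` and ground states `x N`; given `κ > 0`, the trial
  bound gives eventually `4q E(N) ≤ N(γκ/4 − Φ_hcp)`; domination with `ε = γκ/8` and
  `R ≥ max δ (16384/(δ³γκ))` supplies `R` and an antisymmetric transfer `g`, and on
  `S = range (x N)` the bookkeeping `defect_count_le_of_transfer` gives
  `γ D_N ≤ Nε + N·2048/(δ³R^{q−3}) + NΦ_hcp + 4q E(N)` with `2048/(δ³R^{q−3}) ≤ γκ/8`; hence
  `D_N/N ≤ κ/2 < κ`, i.e. the defect fraction tends to `0`.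

[folklore bookkeeping; Theil2006 §4 / BlancLewin2015 §2 for the scheme]
-/

noncomputable section

namespace Summit.AtomisticToContinuum.Crystallization.Theorems.OneCentreSteepnessLadderZeroDensity

open scoped BigOperators
open Literature.MathematicalPhysics.StatisticalMechanics
open Summit.AtomisticToContinuum.Crystallization.Theorems.ExcessDecayLiouville
  (sum_inv_pow_le_of_separated)
open Summit.AtomisticToContinuum.Crystallization.Theorems.ChargedEnergyGapNegative.Blocks
  (BIdx bpt bpt_mem bpt_injective blockConfig blockConfig_apply blockConfig_injective card_BIdx
    depth)

variable {a h : ℝ}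

/-- **Row bound.** In the block configuration of an `m`-separated periodic configuration, every
partial row sum of the Mie potential is `≥ −(1/q)·1024/(m³ m^{q−3})` (`V_q ≥ −r⁻ᵠ/q`, dyadic
shells). [folklore] -/
theorem sum_miePotential_block_ge (Q : PeriodicConfiguration 3) {m : ℝ} (hm : 0 < m)
    (hsep : ∀ x ∈ Q.points, ∀ y ∈ Q.points, x ≠ y → m ≤ dist x y) {q : ℕ} (hq : 4 ≤ q) (K : ℕ)
    (i : Fin (Fintype.card (BIdx Q K))) (T : Finset (Fin (Fintype.card (BIdx Q K)))) :
    -(1 / (q : ℝ)) * (1024 / (m ^ 3 * m ^ (q - 3))) ≤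
      ∑ k ∈ T, miePotential q (dist (blockConfig Q K i) (blockConfig Q K k)) := by
  classical
  obtain ⟨k₀, rfl⟩ : ∃ k₀, q = k₀ + 3 := ⟨q - 3, by omega⟩
  have hk₀ : 1 ≤ k₀ := by omega
  rw [Nat.add_sub_cancel]
  set b := blockConfig Q K with hb
  have hbinj : Function.Injective b := blockConfig_injective Q K
  have hbmem : ∀ j, b j ∈ Q.points := fun j => by
    rw [hb, blockConfig_apply]; exact bpt_mem Q K _
  have h1 : ∑ k ∈ T, -(1 / ((k₀ + 3 : ℕ) : ℝ)) * (dist (b i) (b k))⁻¹ ^ (k₀ + 3) ≤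
      ∑ k ∈ T, miePotential (k₀ + 3) (dist (b i) (b k)) :=
    Finset.sum_le_sum fun k _ => neg_mul_inv_pow_le_miePotential (by omega) _
  have h2 : ∑ k ∈ T, (dist (b i) (b k))⁻¹ ^ (k₀ + 3) ≤ ∑ k, (dist (b i) (b k))⁻¹ ^ (k₀ + 3) :=
    Finset.sum_le_sum_of_subset_of_nonneg (Finset.subset_univ T) fun _ _ _ => by positivity
  have h3 : ∑ k, (dist (b i) (b k))⁻¹ ^ (k₀ + 3) =
      ∑ k ∈ Finset.univ.erase i, (dist (b i) (b k))⁻¹ ^ (k₀ + 3) := by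
    rw [← Finset.add_sum_erase _ _ (Finset.mem_univ i), dist_self, inv_zero,
      zero_pow (by omega), zero_add]
  have hinj : Set.InjOn b ((Finset.univ.erase i : Finset _) : Set _) := hbinj.injOn
  have hfar : ∀ x ∈ (Finset.univ.erase i).image b, m ≤ dist x (b i) := by
    intro x hx
    obtain ⟨k, hk, rfl⟩ := Finset.mem_image.1 hx
    exact hsep _ (hbmem k) _ (hbmem i) (hbinj.ne (Finset.ne_of_mem_erase hk))
  have hsep' : ∀ x ∈ (Finset.univ.erase i).image b, ∀ y ∈ (Finset.univ.erase i).image b,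
      x ≠ y → m ≤ dist x y := by
    intro x hx y hy hxy
    obtain ⟨k, -, rfl⟩ := Finset.mem_image.1 hx
    obtain ⟨k', -, rfl⟩ := Finset.mem_image.1 hy
    exact hsep _ (hbmem k) _ (hbmem k') hxy
  have h4 := sum_inv_pow_le_of_separated ((Finset.univ.erase i).image b) (b i) hk₀ hm le_rfl
    hsep' hfar
  rw [Finset.sum_image hinj] at h4
  have h5 : ∑ k ∈ Finset.univ.erase i, (dist (b i) (b k))⁻¹ ^ (k₀ + 3) ≤
      1024 / (m ^ 3 * m ^ k₀) :=
    le_trans (le_of_eq (Finset.sum_congr rfl fun k _ => by rw [dist_comm])) h4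
  have hc : 0 < 1 / ((k₀ + 3 : ℕ) : ℝ) := by positivity
  calc -(1 / ((k₀ + 3 : ℕ) : ℝ)) * (1024 / (m ^ 3 * m ^ k₀))
      ≤ -(1 / ((k₀ + 3 : ℕ) : ℝ)) * ∑ k ∈ T, (dist (b i) (b k))⁻¹ ^ (k₀ + 3) := by
        rw [neg_mul, neg_mul, neg_le_neg_iff]
        exact mul_le_mul_of_nonneg_left (h2.trans (h3.le.trans h5)) hc.le
    _ = ∑ k ∈ T, -(1 / ((k₀ + 3 : ℕ) : ℝ)) * (dist (b i) (b k))⁻¹ ^ (k₀ + 3) := by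
        rw [Finset.mul_sum]
    _ ≤ _ := h1

/-- **Sub-configurations of a block.** For every index set `S` of the block of `n_K` points of an
`m`-separated periodic configuration, `4q · E(#S) ≤ 4q · 𝓔(block_K) + 6 · #Sᶜ · 1024/(m³ m^{q−3})`:
`2E(#S) ≤ Σ_{S×S} V` (`two_mul_groundStateEnergy_card_le`), the full double sum is `2𝓔(block)`,
and each of the three complementary parts is `≥ −#Sᶜ · (1/q) · 1024/(m³m^{q−3})` by the row
bound. [folklore] -/
theorem four_q_groundStateEnergy_card_le (Q : PeriodicConfiguration 3) {m : ℝ} (hm : 0 < m)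
    (hsep : ∀ x ∈ Q.points, ∀ y ∈ Q.points, x ≠ y → m ≤ dist x y) {q : ℕ} (hq : 4 ≤ q) (K : ℕ)
    (S : Finset (Fin (Fintype.card (BIdx Q K)))) :
    4 * (q : ℝ) * groundStateEnergy (miePotential q) 3 S.card ≤
      4 * (q : ℝ) * interactionEnergy (miePotential q) (blockConfig Q K) +
        6 * (Sᶜ.card : ℝ) * (1024 / (m ^ 3 * m ^ (q - 3))) := by
  classical
  have hq0 : q ≠ 0 := by omega
  have hqpos : (0 : ℝ) < q := Nat.cast_pos.2 (by omega)
  set b := blockConfig Q K with hb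
  set C₀ := 1024 / (m ^ 3 * m ^ (q - 3)) with hC₀
  set W : Fin (Fintype.card (BIdx Q K)) → Fin (Fintype.card (BIdx Q K)) → ℝ :=
    fun i k => miePotential q (dist (b i) (b k)) with hW
  have hrow : ∀ i (T : Finset _), -(1 / (q : ℝ)) * C₀ ≤ ∑ k ∈ T, W i k :=
    fun i T => sum_miePotential_block_ge Q hm hsep hq K i T
  have hcol : ∀ (T T' : Finset _), -(T'.card : ℝ) * ((1 / (q : ℝ)) * C₀) ≤
      ∑ i ∈ T, ∑ k ∈ T', W i k := by
    intro T T'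
    rw [Finset.sum_comm]
    have hsymm : ∑ k ∈ T', ∑ i ∈ T, W i k = ∑ k ∈ T', ∑ i ∈ T, W k i :=
      Finset.sum_congr rfl fun k _ => Finset.sum_congr rfl fun i _ => by
        simp only [hW, dist_comm]
    rw [hsymm]
    calc -(T'.card : ℝ) * ((1 / (q : ℝ)) * C₀) = ∑ _k ∈ T', -(1 / (q : ℝ)) * C₀ := by
          rw [Finset.sum_const, nsmul_eq_mul]; ring
      _ ≤ ∑ k ∈ T', ∑ i ∈ T, W k i := Finset.sum_le_sum fun k _ => hrow k T
  have hrows : ∀ (T T' : Finset _), -(T.card : ℝ) * ((1 / (q : ℝ)) * C₀) ≤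
      ∑ i ∈ T, ∑ k ∈ T', W i k := by
    intro T T'
    calc -(T.card : ℝ) * ((1 / (q : ℝ)) * C₀) = ∑ _i ∈ T, -(1 / (q : ℝ)) * C₀ := by
          rw [Finset.sum_const, nsmul_eq_mul]; ring
      _ ≤ ∑ i ∈ T, ∑ k ∈ T', W i k := Finset.sum_le_sum fun i _ => hrow i T'
  have h1 := two_mul_groundStateEnergy_card_le (miePotential q) (miePotential_zero hq0)
    (neg_one_div_le_miePotential hq0) (blockConfig_injective Q K) S
  have h2 := sum_sum_eq_add_compl W S
  have h3 := two_mul_interactionEnergy_eq_sum_sum (miePotential q) (miePotential_zero hq0) b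
  have hA := hrows Sᶜ Sᶜ
  have hB := hcol S Sᶜ
  have hC := hrows Sᶜ S
  have hSS : ∑ i ∈ S, ∑ k ∈ S, W i k ≤
      2 * interactionEnergy (miePotential q) b + 3 * (Sᶜ.card : ℝ) * ((1 / (q : ℝ)) * C₀) := by
    have : ∑ i, ∑ k, W i k = 2 * interactionEnergy (miePotential q) b := h3.symm
    linarith
  have h4 : 2 * groundStateEnergy (miePotential q) 3 S.card ≤
      2 * interactionEnergy (miePotential q) b + 3 * (Sᶜ.card : ℝ) * ((1 / (q : ℝ)) * C₀) :=
    h1.trans hSS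
  have h5 := mul_le_mul_of_nonneg_left h4 (le_of_lt (mul_pos two_pos hqpos))
  have hq' : (q : ℝ) ≠ 0 := hqpos.ne'
  calc 4 * (q : ℝ) * groundStateEnergy (miePotential q) 3 S.card
      = 2 * (q : ℝ) * (2 * groundStateEnergy (miePotential q) 3 S.card) := by ring
    _ ≤ 2 * (q : ℝ) * (2 * interactionEnergy (miePotential q) b +
          3 * (Sᶜ.card : ℝ) * ((1 / (q : ℝ)) * C₀)) := h5
    _ = 4 * (q : ℝ) * interactionEnergy (miePotential q) b + 6 * (Sᶜ.card : ℝ) * C₀ := by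
        field_simp
        ring

/-- Integer bookkeeping for the block size: if `K ≥ 2` and `F (K−1)³ < N ≤ F K³` with `F ≥ 1`,
then `K³ < 8N` and `F K³ − N ≤ 3 F K²` (as real numbers). [folklore] -/
theorem block_size_bounds {F K N : ℕ} (hF : 1 ≤ F) (hK : 2 ≤ K) (hlt : F * (K - 1) ^ 3 < N) :
    ((K : ℝ)) ^ 3 < 8 * N ∧ (F : ℝ) * (K : ℝ) ^ 3 - N ≤ 3 * F * (K : ℝ) ^ 2 := by
  obtain ⟨L, rfl⟩ : ∃ L, K = L + 1 := ⟨K - 1, by omega⟩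
  rw [Nat.add_sub_cancel] at hlt
  have hL : (1 : ℝ) ≤ L := by exact_mod_cast (show 1 ≤ L by omega)
  have hFr : (1 : ℝ) ≤ F := by exact_mod_cast hF
  have hltr : (F : ℝ) * (L : ℝ) ^ 3 < N := by exact_mod_cast hlt
  have hL3 : (L : ℝ) ^ 3 ≤ (F : ℝ) * (L : ℝ) ^ 3 := by
    have : 0 ≤ (L : ℝ) ^ 3 := by positivity
    nlinarith
  push_cast
  constructor
  · nlinarith [hL3, hltr, pow_pos (zero_lt_one.trans_le hL) 2]
  · have hF0 : (0 : ℝ) ≤ F := by linarith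
    nlinarith [mul_nonneg hF0 (zero_le_one.trans hL), hltr]

/-- The real arithmetic of the trial bound, isolated: the sub-configuration bound, the block
bound and the integer bookkeeping combine to `4qE(N) ≤ N(θ − Φ)`. [folklore] -/
theorem trial_arith {E Eb Φ τ C₀ θ F K N ρ' : ℝ} (hF : 0 ≤ F) (hC₀ : 0 ≤ C₀) (hτ0 : 0 ≤ τ)
    (hθ : 0 < θ) (hρ' : 0 ≤ ρ') (hN : 0 ≤ N)
    (hrem : E ≤ Eb + 6 * (F * K ^ 3 - N) * C₀)
    (hblock : Eb ≤ -(F * K ^ 3) * Φ + 2 * (F * K ^ 3) * τ + 12 * F * ρ' * K ^ 2 * C₀)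
    (hK8 : K ^ 3 < 8 * N) (hKdiff : F * K ^ 3 - N ≤ 3 * F * K ^ 2) (hNn : N ≤ F * K ^ 3)
    (hτ : 16 * F * τ ≤ θ / 2)
    (hKr : 16 * (3 * F * |Φ| + (12 * F * ρ' + 18 * F) * C₀) / θ ≤ K) :
    E ≤ N * (θ - Φ) := by
  set C₁ := 3 * F * |Φ| + (12 * F * ρ' + 18 * F) * C₀ with hC₁
  have hC₁0 : 0 ≤ C₁ := by rw [hC₁]; positivity
  -- the four elementary products
  have e1 : (F * K ^ 3 - N) * C₀ ≤ 3 * F * K ^ 2 * C₀ := mul_le_mul_of_nonneg_right hKdiff hC₀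
  have e2 : (N - F * K ^ 3) * Φ ≤ 3 * F * K ^ 2 * |Φ| :=
    calc (N - F * K ^ 3) * Φ ≤ |(N - F * K ^ 3) * Φ| := le_abs_self _
      _ = |F * K ^ 3 - N| * |Φ| := by rw [abs_mul, abs_sub_comm]
      _ ≤ 3 * F * K ^ 2 * |Φ| := by
          rw [abs_of_nonneg (sub_nonneg.2 hNn)]
          exact mul_le_mul_of_nonneg_right hKdiff (abs_nonneg _)
  have e3 : F * K ^ 3 * τ ≤ 8 * F * N * τ := by
    have h8 : F * K ^ 3 ≤ 8 * F * N := by nlinarith [mul_le_mul_of_nonneg_left hK8.le hF]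
    exact mul_le_mul_of_nonneg_right h8 hτ0
  have e4 : F * N * τ ≤ N * (θ / 32) := by
    have := mul_le_mul_of_nonneg_left hτ hN
    nlinarith [this]
  have e5 : C₁ * K ^ 2 ≤ N * (θ / 2) := by
    have h1 : C₁ ≤ θ * K / 16 := by
      rw [div_le_iff₀ hθ] at hKr
      linarith
    calc C₁ * K ^ 2 ≤ θ * K / 16 * K ^ 2 := mul_le_mul_of_nonneg_right h1 (by positivity)
      _ = θ / 16 * K ^ 3 := by ring
      _ ≤ θ / 16 * (8 * N) := by gcongr
      _ = N * (θ / 2) := by ring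
  have e6 : C₁ * K ^ 2 =
      3 * F * K ^ 2 * |Φ| + (12 * F * ρ' * K ^ 2 * C₀ + 18 * F * K ^ 2 * C₀) := by
    rw [hC₁]; ring
  nlinarith [hrem, hblock, e1, e2, e3, e4, e5, e6]

/-- **The trial-state upper bound.** For `a, h > 0`, `q ≥ 4` and every `θ > 0`, eventually in `N`
`4q · E_{V_q}(N) ≤ N · (θ − Φ_hcp)`, `Φ_hcp = Σ'_{p ∈ hcpStacking a h} φ_q(‖p‖)`: blocks of HCP
with `n_K = #F K³ ≥ N > #F (K−1)³` points, thinned to `N` points, are admissible trial states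
whose energy is `−n_K Φ_hcp/(4q)` up to `O(N·R^{3−q}) + O_R(K²)`. [folklore] -/
theorem trial_bound (ha : 0 < a) (hh : 0 < h) {q : ℕ} (hq : 4 ≤ q) {θ : ℝ} (hθ : 0 < θ) :
    ∃ N₀ : ℕ, ∀ N : ℕ, N₀ ≤ N →
      4 * (q : ℝ) * groundStateEnergy (miePotential q) 3 N ≤
        N * (θ - ∑' p : ↥(hcpStacking a h), (2 * (‖(p : EuclideanSpace ℝ (Fin 3))‖)⁻¹ ^ q -
          (‖(p : EuclideanSpace ℝ (Fin 3))‖)⁻¹ ^ (2 * q))) := by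
  classical
  -- constants: motif size `F`, separation `m`, `C₀`
  have hF1' : 1 ≤ (hcpPeriodicConfiguration ha.ne' hh.ne').motif.card :=
    (hcpPeriodicConfiguration ha.ne' hh.ne').motif_nonempty.card_pos
  obtain ⟨F, hF⟩ : ∃ F : ℕ, (hcpPeriodicConfiguration ha.ne' hh.ne').motif.card = F := ⟨_, rfl⟩
  have hF1 : 1 ≤ F := hF ▸ hF1'
  have hFr : (1 : ℝ) ≤ F := by exact_mod_cast hF1
  have hm : 0 < min a h := lt_min ha hh
  have hsepQ := hcpConfig_separated ha hh
  have hC₀0 : (0 : ℝ) ≤ 1024 / ((min a h) ^ 3 * (min a h) ^ (q - 3)) := by positivity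
  -- the truncation radius `R` and its tail `τ`
  obtain ⟨R, hR⟩ : ∃ R : ℝ, R = max (max 1 (min a h)) (32768 * F / ((min a h) ^ 3 * θ)) :=
    ⟨_, rfl⟩
  have hR1 : 1 ≤ R := hR ▸ (le_max_left _ _).trans (le_max_left _ _)
  have hRm : min a h ≤ R := hR ▸ (le_max_right _ _).trans (le_max_left _ _)
  have hR2 : 32768 * F / ((min a h) ^ 3 * θ) ≤ R := hR ▸ le_max_right _ _
  have hRpos : 0 < R := zero_lt_one.trans_le hR1
  have hτ0 : (0 : ℝ) ≤ 1024 / ((min a h) ^ 3 * R ^ (q - 3)) := by positivity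
  have hτ_le : 16 * (F : ℝ) * (1024 / ((min a h) ^ 3 * R ^ (q - 3))) ≤ θ / 2 := by
    have hRq : R ≤ R ^ (q - 3) := le_self_pow₀ hR1 (by omega)
    have hτ1 : 1024 / ((min a h) ^ 3 * R ^ (q - 3)) ≤ 1024 / ((min a h) ^ 3 * R) := by gcongr
    have hm3 : 0 < (min a h) ^ 3 := by positivity
    rw [div_le_iff₀ (by positivity)] at hR2
    have hτ2 : 1024 / ((min a h) ^ 3 * R) ≤ θ / (32 * F) := by
      rw [div_le_div_iff₀ (by positivity) (by positivity)]
      linarith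
    calc 16 * (F : ℝ) * (1024 / ((min a h) ^ 3 * R ^ (q - 3))) ≤ 16 * F * (θ / (32 * F)) :=
          mul_le_mul_of_nonneg_left (hτ1.trans hτ2) (by positivity)
      _ = θ / 2 := by field_simp; ring
  -- the depth `ρ'`, the `K²`-coefficient and the threshold
  obtain ⟨ρ', hρ'⟩ : ∃ ρ' : ℕ, depth (hcpPeriodicConfiguration ha.ne' hh.ne') R = ρ' := ⟨_, rfl⟩
  obtain ⟨C₁, hC₁⟩ : ∃ C₁ : ℝ, C₁ = 3 * (F : ℝ) *
      |∑' p : ↥(hcpStacking a h), (2 * (‖(p : EuclideanSpace ℝ (Fin 3))‖)⁻¹ ^ q -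
        (‖(p : EuclideanSpace ℝ (Fin 3))‖)⁻¹ ^ (2 * q))| +
      (12 * F * ρ' + 18 * F) * (1024 / ((min a h) ^ 3 * (min a h) ^ (q - 3))) := ⟨_, rfl⟩
  obtain ⟨K₁, hK₁⟩ : ∃ K₁ : ℕ, K₁ = ⌈16 * C₁ / θ⌉₊ + 1 := ⟨_, rfl⟩
  refine ⟨F * K₁ ^ 3 + 1, fun N hN => ?_⟩
  -- choose the block size `K`: minimal with `N ≤ F K³`
  have hex : ∃ K : ℕ, N ≤ F * K ^ 3 :=
    ⟨N, le_trans (Nat.le_self_pow three_ne_zero N) (Nat.le_mul_of_pos_left _ hF1)⟩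
  obtain ⟨K, hK⟩ : ∃ K : ℕ, K = Nat.find hex := ⟨_, rfl⟩
  have hNK : N ≤ F * K ^ 3 := hK ▸ Nat.find_spec hex
  have hKK₁ : K₁ + 1 ≤ K := by
    by_contra hlt
    have hle : K ≤ K₁ := by omega
    have : F * K ^ 3 ≤ F * K₁ ^ 3 := Nat.mul_le_mul_left _ (Nat.pow_le_pow_left hle 3)
    omega
  have hK2 : 2 ≤ K := by omega
  have hmin : F * (K - 1) ^ 3 < N := by
    have := Nat.find_min hex (show K - 1 < Nat.find hex by omega)
    omega
  obtain ⟨hK8, hKdiff⟩ := block_size_bounds hF1 hK2 hmin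
  have hKr : (16 * C₁ / θ : ℝ) ≤ K := by
    have h1 : (16 * C₁ / θ : ℝ) ≤ ⌈16 * C₁ / θ⌉₊ := Nat.le_ceil _
    have h2 : ((⌈16 * C₁ / θ⌉₊ : ℕ) : ℝ) ≤ K := by
      exact_mod_cast (show ⌈16 * C₁ / θ⌉₊ ≤ K by omega)
    exact h1.trans h2
  -- the block and a sub-configuration of exactly `N` points
  have hcard : Fintype.card (BIdx (hcpPeriodicConfiguration ha.ne' hh.ne') K) = F * K ^ 3 := by
    rw [card_BIdx, hF]
  obtain ⟨S, -, hS⟩ : ∃ S ⊆ (Finset.univ :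
      Finset (Fin (Fintype.card (BIdx (hcpPeriodicConfiguration ha.ne' hh.ne') K)))),
      S.card = N :=
    Finset.exists_subset_card_eq (by rw [Finset.card_univ, Fintype.card_fin, hcard]; exact hNK)
  have hSc_nat : Sᶜ.card = F * K ^ 3 - N := by
    rw [Finset.card_compl, Fintype.card_fin, hS, hcard]
  have hSc : ((Sᶜ.card : ℕ) : ℝ) = (F : ℝ) * (K : ℝ) ^ 3 - N := by
    rw [hSc_nat, Nat.cast_sub hNK]
    push_cast
    ring
  have hrem := four_q_groundStateEnergy_card_le (hcpPeriodicConfiguration ha.ne' hh.ne') hm hsepQ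
    hq K S
  rw [hS, hSc] at hrem
  have hblock := four_q_energy_block_le ha hh hq hRm K
  have hn : ((Fintype.card (BIdx (hcpPeriodicConfiguration ha.ne' hh.ne') K) : ℕ) : ℝ) =
      (F : ℝ) * (K : ℝ) ^ 3 := by
    rw [hcard]
    push_cast
    ring
  rw [hn, hF, hρ'] at hblock
  -- conclude with the real arithmetic
  refine trial_arith (zero_le_one.trans hFr) hC₀0 hτ0 hθ (Nat.cast_nonneg ρ')
    (Nat.cast_nonneg N) hrem ?_ hK8 hKdiff (by exact_mod_cast hNK) hτ_le (hC₁ ▸ hKr)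
  convert hblock using 2

end Summit.AtomisticToContinuum.Crystallization.Theorems.OneCentreSteepnessLadderZeroDensity

namespace Summit.AtomisticToContinuum.Crystallization.Theorems

open scoped BigOperators
open Literature.MathematicalPhysics.StatisticalMechanics
open Summit.AtomisticToContinuum.Crystallization.Theorems.OneCentreSteepnessLadderZeroDensity
open Filter

/-- **Item `ZeroDensityOfDefects`** (stmt-AtomisticToContinuum-12886, route
`OneCentreSteepnessLadder`): for `q ≥ 4`, `δ, a, h > 0`, δ-separation of the Mie `(2q,q)`
ground states and coercive one-centre domination at `(q, δ, a, h)` imply that, for every `η > 0`,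
the fraction of `η`-defective centres tends to `0` along every sequence of ground states.
(Transfers cancel by antisymmetry on the finite set `range (x N)`; the truncation tail is
`O(δ⁻³R^{3−q})`; the trial bound `4qE(N) ≤ −NΦ_hcp + o(N)` comes from blocks of
`hcpStacking a h`.) [folklore] -/
theorem oneCentreSteepnessLadder_zeroDensityOfDefects :
    Summit.AtomisticToContinuum.Crystallization.Theses.OneCentreSteepnessLadder.ZeroDensityOfDefects := by
  unfold Summit.AtomisticToContinuum.Crystallization.Theses.OneCentreSteepnessLadder.ZeroDensityOfDefects
  intro q hq δ a h hδ ha hh hsep hdom η hη x hx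
  classical
  obtain ⟨γ, hγ, hdom'⟩ := hdom η hη
  set Φ := ∑' p : ↥(hcpStacking a h), (2 * (‖(p : EuclideanSpace ℝ (Fin 3))‖)⁻¹ ^ q -
    (‖(p : EuclideanSpace ℝ (Fin 3))‖)⁻¹ ^ (2 * q)) with hΦ
  rw [Metric.tendsto_atTop]
  intro κ hκ
  have hγκ : 0 < γ * κ := mul_pos hγ hκ
  -- the trial bound with `θ = γκ/4`
  obtain ⟨N₁, hN₁⟩ := trial_bound ha hh hq (θ := γ * κ / 4) (by positivity)
  -- domination with `ε = γκ/8` and a radius beyond `max δ (16384/(δ³ γκ))`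
  obtain ⟨R, hR₀, g, -, hS⟩ := hdom' (γ * κ / 8) (by positivity)
    (max (max 1 δ) (16384 / (δ ^ 3 * (γ * κ))))
  have hR1 : 1 ≤ R := ((le_max_left _ _).trans (le_max_left _ _)).trans hR₀
  have hRδ : δ ≤ R := ((le_max_right _ _).trans (le_max_left _ _)).trans hR₀
  have hRpos : 0 < R := zero_lt_one.trans_le hR1
  have htailR : 2048 / (δ ^ 3 * R ^ (q - 3)) ≤ γ * κ / 8 := by
    have hRq : R ≤ R ^ (q - 3) := le_self_pow₀ hR1 (by omega)
    have h1 : 2048 / (δ ^ 3 * R ^ (q - 3)) ≤ 2048 / (δ ^ 3 * R) := by gcongr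
    have h2 : 16384 / (δ ^ 3 * (γ * κ)) ≤ R := (le_max_right _ _).trans hR₀
    rw [div_le_iff₀ (by positivity)] at h2
    have h3 : 2048 / (δ ^ 3 * R) ≤ γ * κ / 8 := by
      rw [div_le_div_iff₀ (by positivity) (by norm_num)]
      nlinarith
    exact h1.trans h3
  refine ⟨max N₁ 1, fun N hN => ?_⟩
  have hNN₁ : N₁ ≤ N := (le_max_left _ _).trans hN
  have hN1 : 1 ≤ N := (le_max_right _ _).trans hN
  have hNpos : (0 : ℝ) < N := by exact_mod_cast hN1
  -- the ground state `z = x N`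
  set z := x N with hz
  have hzinj : Function.Injective z := (hx N).1
  have hzE : interactionEnergy (miePotential q) z = groundStateEnergy (miePotential q) 3 N :=
    (hx N).2
  have hsepz : ∀ i j, i ≠ j → δ ≤ dist (z i) (z j) := hsep N z (hx N)
  have hsepS : ∀ u ∈ Set.range z, ∀ v ∈ Set.range z, u ≠ v → δ ≤ dist u v := by
    rintro _ ⟨i, rfl⟩ _ ⟨j, rfl⟩ hne
    exact hsepz i j fun hij => hne (hij ▸ rfl)
  obtain ⟨hanti, hpt⟩ := hS (Set.range z) hsepS
  -- the defect predicate over indices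
  set D : Fin N → Prop := fun i =>
    ¬ (∃ A : EuclideanSpace ℝ (Fin 3) →ₗᵢ[ℝ] EuclideanSpace ℝ (Fin 3),
    (∀ p ∈ hcpStacking a h, ‖p‖ ≤ 5 / 3 * a → ∃ j : Fin N, dist (z j) (z i + A p) ≤ η) ∧
    (∀ j : Fin N, dist (z j) (z i) ≤ 5 / 3 * a →
      ∃ p ∈ hcpStacking a h, dist (z j) (z i + A p) ≤ η)) with hD
  have hcount := defect_count_le_of_transfer hq hδ hRδ z hzinj hsepz Φ (γ * κ / 8) γ g
    (fun u => ((fun w : EuclideanSpace ℝ (Fin 3) => w - u) '' Set.range z) ∩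
      Metric.closedBall (0 : EuclideanSpace ℝ (Fin 3)) R) D
    (fun i j => hanti (z i) ⟨i, rfl⟩ (z j) ⟨j, rfl⟩)
    (fun i => (hpt (z i) ⟨i, rfl⟩).1)
    (fun i hi => (hpt (z i) ⟨i, rfl⟩).2 (by
      rintro ⟨A, hA⟩
      exact hi ⟨A, (matched_range_iff z (hcpStacking a h) (5 / 3 * a) η (z i) A).1 hA⟩))
  -- combine with the trial bound
  have htrial := hN₁ N hNN₁
  rw [← hzE] at htrial
  have hcard : γ * ((Finset.univ.filter D).card : ℝ) ≤ N * (γ * κ / 2) := by nlinarith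
  have hfrac : ((Finset.univ.filter D).card : ℝ) / N ≤ κ / 2 := by
    rw [div_le_iff₀ hNpos]
    have : γ * ((Finset.univ.filter D).card : ℝ) ≤ γ * (κ / 2 * N) := by linarith
    exact le_of_mul_le_mul_left this hγ
  have hnat : (Nat.card {i : Fin N // D i} : ℝ) = ((Finset.univ.filter D).card : ℝ) := by
    rw [Nat.card_eq_fintype_card, Fintype.card_subtype]
  rw [Real.dist_eq, sub_zero, hnat, abs_of_nonneg (by positivity)]
  linarith

end Summit.AtomisticToContinuum.Crystallization.Theorems

end
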